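import Mathlib
import Summits.Ventures.PercRepro2.Defs
import Summits.Ventures.PercRepro2.Independence
import Summits.Ventures.PercRepro2.Harris
import Summits.Ventures.PercRepro2.Graph
import Summits.Ventures.PercRepro2.Exploration
import Summits.Ventures.PercRepro2.Events
import Summits.Ventures.PercRepro2.FourFunctions
import Summits.Ventures.PercRepro2.Induced
import Summits.Ventures.PercRepro2.Frontier
import Summits.Ventures.PercRepro2.ObsIndependence
import Summits.Ventures.PercRepro2.BHK

/-!
# The two van den Berg–Häggström–Kahn inequalities on the whole graph
(blind cell PercRepro2, p1)

Both halves of BHK06 (doi:10.1002/rsa.20102) in the vocabulary of `Events.lean`, conditionally on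
the avoidance `{s ↮ t}` (stated in the unconditional, multiplied-out form):

* `bhk_same_cluster` (Thm 1.3, same cluster, POSITIVE): for nonnegative monotone cluster
  functionals `F₁ F₂`,
  `E[F₁(C_s) 1_{s↮t}] · E[F₂(C_s) 1_{s↮t}] ≤ E[(F₁F₂)(C_s) 1_{s↮t}] · P(s↮t)`;
* `bhk_cross_cluster` (Thm 1.4, different clusters, NEGATIVE): for up-sets `𝓤, 𝓥` of vertex
  sets, `P(C_s ∈ 𝓤, C_t ∈ 𝓥, s↮t) · P(s↮t) ≤ P(C_s ∈ 𝓤, s↮t) · P(C_t ∈ 𝓥, s↮t)`.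

The second is derived from the first exactly as in BHK06: explore the cluster `W` of `s`; on
`{C_s = W, t ∉ W}` the cluster of `t` is its cluster in `G ∖ W` (`conn_restrict_iff_of_cluster_eq`),
so by the tower identity `P(C_s ∈ 𝓤, C_t ∈ 𝓥, s↮t) = E[1_𝓤(C_s) g(C_s) 1_{s↮t}]` with
`g(W) = P(C_t ∈ 𝓥 in G ∖ W)` (`delClusterProb`), which is antitone in `W` and lies in `[0, 1]`;
then `bhk_same_cluster` with `F₂ = 1 − g` gives the claim.
-/

namespace Summit.Ventures.PercRepro2

section WholeGraph

variable {V : Type*} {E : Type*} [Fintype E] [DecidableEq E] [Fintype V] [DecidableEq V]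
  {R : Type*} [CommRing R] [LinearOrder R] [IsStrictOrderedRing R]

omit [Fintype E] [DecidableEq E] [DecidableEq V] in
/-- On the full vertex set, `clusterIn` is the cluster. -/
lemma clusterIn_univ (ends : E → Sym2 V) (s : V) (ω : Config E) :
    clusterIn ends Finset.univ s ω = cluster ends ω s := by
  simp only [clusterIn, Finset.coe_univ, induced_univ]

omit [Fintype E] [DecidableEq E] [DecidableEq V] in
/-- `R^{univ}_{{t}} = {s ↮ t}`. -/
lemma REvent_univ_singleton (ends : E → Sym2 V) (s t : V) :
    REvent ends Finset.univ s {t} = (connEvent ends s t)ᶜ := by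
  ext ω
  simp [Finset.coe_univ, induced_univ]

/-- **BHK, same cluster** (BHK06 Thm 1.3, multiplied out): for nonnegative monotone cluster
functionals `F₁, F₂` of the cluster of `s`,
`E[F₁(C_s) 1_{s↮t}] · E[F₂(C_s) 1_{s↮t}] ≤ E[(F₁F₂)(C_s) 1_{s↮t}] · P(s↮t)`. -/
theorem bhk_same_cluster (p : E → R) (hp : IsProbVec p) (ends : E → Sym2 V) (s t : V)
    {F₁ F₂ : Set V → R} (hF₁ : Monotone F₁) (hF₂ : Monotone F₂) (hF₁0 : ∀ S, 0 ≤ F₁ S)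
    (hF₂0 : ∀ S, 0 ≤ F₂ S) :
    expect p (fun ω => F₁ (cluster ends ω s) * ((connEvent ends s t)ᶜ).indicator 1 ω) *
        expect p (fun ω => F₂ (cluster ends ω s) * ((connEvent ends s t)ᶜ).indicator 1 ω) ≤
      expect p (fun ω => F₁ (cluster ends ω s) * F₂ (cluster ends ω s) *
          ((connEvent ends s t)ᶜ).indicator 1 ω) *
        prob p (connEvent ends s t)ᶜ := by
  have h := bhk_induced p hp ends s hF₁ hF₂ hF₁0 hF₂0 Finset.univ {t} {t} (Finset.subset_univ _)
    (Finset.subset_univ _)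
  simp only [Finset.inter_self, Finset.union_self, REvent_univ_singleton] at h
  have e : ∀ F : Set V → R, clusterObs ends Finset.univ s F * ((connEvent ends s t)ᶜ).indicator 1 =
      fun ω => F (cluster ends ω s) * ((connEvent ends s t)ᶜ).indicator 1 ω := by
    intro F
    funext ω
    simp only [Pi.mul_apply, clusterObs_apply, clusterIn_univ]
  rw [e, e, e] at h
  exact h

omit [Fintype V] [DecidableEq V] [LinearOrder R] [IsStrictOrderedRing R] in
/-- The indicator of `{C_s ∈ 𝓤} ∩ A` is `1_𝓤(C_s) · 1_A`, so its probability is the expectation. -/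
lemma prob_clusterInEvent_inter_eq_expect (p : E → R) (ends : E → Sym2 V) (s : V)
    (𝓤 : Set (Set V)) (A : Set (Config E)) :
    prob p (clusterInEvent ends s 𝓤 ∩ A) =
      expect p (fun ω => 𝓤.indicator 1 (cluster ends ω s) * A.indicator 1 ω) := by
  rw [prob_eq_expect_indicator]
  unfold expect
  refine Finset.sum_congr rfl fun ω _ => ?_
  congr 1
  rw [indicator_inter_one]
  rfl

omit [Fintype V] [DecidableEq V] in
/-- For an up-set `𝓤`, `1_𝓤` is a monotone nonnegative functional. -/
lemma monotone_indicator_one_of_isUpperSet {𝓤 : Set (Set V)} (h𝓤 : IsUpperSet 𝓤) :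
    Monotone (𝓤.indicator (1 : Set V → R)) := by
  intro W W' h
  by_cases hW : W ∈ 𝓤
  · simp [Set.indicator_of_mem hW, Set.indicator_of_mem (h𝓤 h hW)]
  · rw [Set.indicator_of_notMem hW]
    exact Set.indicator_apply_nonneg fun _ => zero_le_one

/-- **BHK, same cluster, for events** (BHK06 Thm 1.2): for up-sets `𝓤, 𝓥` of vertex sets,
`P(C_s ∈ 𝓤, s↮t) · P(C_s ∈ 𝓥, s↮t) ≤ P(C_s ∈ 𝓤, C_s ∈ 𝓥, s↮t) · P(s↮t)`. -/
theorem bhk_same_cluster_events (p : E → R) (hp : IsProbVec p) (ends : E → Sym2 V) (s t : V)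
    {𝓤 𝓥 : Set (Set V)} (h𝓤 : IsUpperSet 𝓤) (h𝓥 : IsUpperSet 𝓥) :
    prob p (clusterInEvent ends s 𝓤 ∩ (connEvent ends s t)ᶜ) *
        prob p (clusterInEvent ends s 𝓥 ∩ (connEvent ends s t)ᶜ) ≤
      prob p (clusterInEvent ends s 𝓤 ∩ clusterInEvent ends s 𝓥 ∩ (connEvent ends s t)ᶜ) *
        prob p (connEvent ends s t)ᶜ := by
  have key := bhk_same_cluster p hp ends s t (monotone_indicator_one_of_isUpperSet (R := R) h𝓤)
    (monotone_indicator_one_of_isUpperSet (R := R) h𝓥)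
    (fun _ => Set.indicator_apply_nonneg fun _ => zero_le_one)
    (fun _ => Set.indicator_apply_nonneg fun _ => zero_le_one)
  rw [← prob_clusterInEvent_inter_eq_expect, ← prob_clusterInEvent_inter_eq_expect] at key
  have e : (fun ω => 𝓤.indicator (1 : Set V → R) (cluster ends ω s) *
      𝓥.indicator 1 (cluster ends ω s) * ((connEvent ends s t)ᶜ).indicator 1 ω) =
      fun ω => (𝓤 ∩ 𝓥).indicator 1 (cluster ends ω s) * ((connEvent ends s t)ᶜ).indicator 1 ω := by
    funext ω
    by_cases h1 : cluster ends ω s ∈ 𝓤 <;> by_cases h2 : cluster ends ω s ∈ 𝓥 <;> simp [h1, h2]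
  rw [e, ← prob_clusterInEvent_inter_eq_expect] at key
  have e2 : clusterInEvent ends s (𝓤 ∩ 𝓥) = clusterInEvent ends s 𝓤 ∩ clusterInEvent ends s 𝓥 := by
    ext ω; simp [clusterInEvent]
  rw [e2] at key
  exact key

end WholeGraph

/-! ## The cross-cluster inequality -/

section DelConfig

variable {V : Type*} {E : Type*} {ends : E → Sym2 V}

/-- `delConfig` is `restrict` to the complement of the touching edges. -/
lemma delConfig_eq_restrict (W : Set V) [DecidablePred (· ∈ (touches ends W)ᶜ)] (ω : Config E) :
    delConfig ends W ω = restrict (touches ends W)ᶜ ω := by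
  funext e
  by_cases h : e ∈ touches ends W
  · rw [delConfig_apply_of_mem h, restrict_apply_of_notMem (show e ∉ (touches ends W)ᶜ from
      fun h' => h' h)]
  · rw [delConfig_apply_of_notMem h, restrict_apply_of_mem (show e ∈ (touches ends W)ᶜ from h)]

/-- `touches` is monotone in the vertex set. -/
lemma touches_mono {W W' : Set V} (h : W ⊆ W') : touches ends W ⊆ touches ends W' :=
  fun _ ⟨x, hx, y, he⟩ => ⟨x, h hx, y, he⟩

/-- Closing more edges gives a smaller configuration. -/
lemma delConfig_anti {W W' : Set V} (h : W ⊆ W') (ω : Config E) :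
    delConfig ends W' ω ≤ delConfig ends W ω := by
  intro e
  by_cases he : e ∈ touches ends W'
  · rw [delConfig_apply_of_mem he]
    exact Bool.false_le _
  · rw [delConfig_apply_of_notMem he, delConfig_apply_of_notMem fun h' => he (touches_mono h h')]

/-- `delConfig ends W` only sees the edges not touching `W`. -/
lemma delConfig_congr {W : Set V} {ω ω' : Config E} (h : ∀ e ∈ (touches ends W)ᶜ, ω e = ω' e) :
    delConfig ends W ω = delConfig ends W ω' := by
  funext e
  by_cases he : e ∈ touches ends W
  · rw [delConfig_apply_of_mem he, delConfig_apply_of_mem he]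
  · rw [delConfig_apply_of_notMem he, delConfig_apply_of_notMem he, h e he]

/-- On `{t ∉ C_s}`, the cluster of `t` is its cluster in `G ∖ C_s`. -/
lemma cluster_delConfig_cluster {ω : Config E} {s t : V} (ht : t ∉ cluster ends ω s) :
    cluster ends (delConfig ends (cluster ends ω s) ω) t = cluster ends ω t := by
  classical
  rw [delConfig_eq_restrict]
  ext w
  simp only [mem_cluster]
  exact conn_restrict_iff_of_cluster_eq rfl ht

end DelConfig

section Cross

variable {V : Type*} {E : Type*} [Fintype E] [DecidableEq E] [Fintype V] [DecidableEq V]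
  {R : Type*} [CommRing R] [LinearOrder R] [IsStrictOrderedRing R]

omit [Fintype V] [DecidableEq V] in
/-- For an up-set `𝓥`, `g` is antitone in `W`. -/
lemma delClusterProb_anti (p : E → R) (hp : IsProbVec p) (ends : E → Sym2 V) (t : V)
    {𝓥 : Set (Set V)} (h𝓥 : IsUpperSet 𝓥) : Antitone (delClusterProb p ends t 𝓥) := by
  intro W W' h
  unfold delClusterProb
  refine prob_mono hp fun ω hω => ?_
  exact h𝓥 (cluster_mono (delConfig_anti h ω) t) hω

omit [Fintype V] [DecidableEq V] in
/-- `0 ≤ g`. -/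
lemma delClusterProb_nonneg (p : E → R) (hp : IsProbVec p) (ends : E → Sym2 V) (t : V)
    (𝓥 : Set (Set V)) (W : Set V) : 0 ≤ delClusterProb p ends t 𝓥 W :=
  prob_nonneg hp _

omit [Fintype V] [DecidableEq V] in
/-- `g ≤ 1`. -/
lemma delClusterProb_le_one (p : E → R) (hp : IsProbVec p) (ends : E → Sym2 V) (t : V)
    (𝓥 : Set (Set V)) (W : Set V) : delClusterProb p ends t 𝓥 W ≤ 1 :=
  prob_le_one hp _

omit [DecidableEq V] [LinearOrder R] [IsStrictOrderedRing R] in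
/-- **Exploring the cluster of `s`**: for families `𝓤, 𝓥` of vertex sets,
`P(C_s ∈ 𝓤, C_t ∈ 𝓥, s ↮ t) = E[1_𝓤(C_s) · g(C_s) · 1_{s↮t}]` with `g = delClusterProb`. -/
theorem prob_clusterIn_inter_eq_expect (p : E → R) (ends : E → Sym2 V) (s t : V)
    (𝓤 𝓥 : Set (Set V)) :
    prob p (clusterInEvent ends s 𝓤 ∩ clusterInEvent ends t 𝓥 ∩ (connEvent ends s t)ᶜ) =
      expect p (fun ω => 𝓤.indicator 1 (cluster ends ω s) *
        delClusterProb p ends t 𝓥 (cluster ends ω s) * ((connEvent ends s t)ᶜ).indicator 1 ω) := by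
  classical
  -- the coefficient `c W = 1_𝓤(W) · 1{t ∉ W}` and the observable `D W = 1{C_t ∈ 𝓥 in G ∖ W}`
  let c : Set V → R := fun W => 𝓤.indicator 1 W * ({W' : Set V | t ∉ W'}.indicator 1 W)
  let D : Set V → Config E → R := fun W =>
    ({ω | cluster ends (delConfig ends W ω) t ∈ 𝓥} : Set (Config E)).indicator 1
  let Φ : Set V → Config E → R := fun W ω => c W * D W ω
  have hΦ : ∀ W, DependsOn (Φ W) (touches ends W)ᶜ := by
    intro W ω ω' h
    simp only [Φ, D]
    congr 1
    refine dependsOn_indicator (R := R) (fun ω ω' h => ?_) h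
    show (cluster ends (delConfig ends W ω) t ∈ 𝓥) = (cluster ends (delConfig ends W ω') t ∈ 𝓥)
    rw [delConfig_congr h]
  have hS : ∀ W : Set V, DependsOn (· ∈ {ω | cluster ends ω s = W}) (touches ends W) :=
    fun W => dependsOn_clusterEvent ends s W
  have hdisj : ∀ W : Set V, Disjoint (touches ends W) (touches ends W)ᶜ :=
    fun W => disjoint_compl_right
  -- pointwise: the indicator of the event is `Φ (C_s ω) ω`
  have hpt : ∀ ω, (clusterInEvent ends s 𝓤 ∩ clusterInEvent ends t 𝓥 ∩
      (connEvent ends s t)ᶜ).indicator (1 : Config E → R) ω = Φ (cluster ends ω s) ω := by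
    intro ω
    simp only [Φ, c, D]
    by_cases hst : t ∈ cluster ends ω s
    · have h1 : ω ∉ clusterInEvent ends s 𝓤 ∩ clusterInEvent ends t 𝓥 ∩ (connEvent ends s t)ᶜ :=
        fun h => h.2 hst
      rw [Set.indicator_of_notMem h1,
        Set.indicator_of_notMem (show cluster ends ω s ∉ {W' : Set V | t ∉ W'} from fun h => h hst)]
      simp
    · have e := cluster_delConfig_cluster (ends := ends) (ω := ω) (s := s) hst
      have hmem : ω ∈ {ω' | cluster ends (delConfig ends (cluster ends ω s) ω') t ∈ 𝓥} ↔
          cluster ends ω t ∈ 𝓥 := by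
        rw [Set.mem_setOf_eq, e]
      rw [Set.indicator_of_mem (show cluster ends ω s ∈ {W' : Set V | t ∉ W'} from hst)]
      by_cases h𝓤 : cluster ends ω s ∈ 𝓤
      · rw [Set.indicator_of_mem h𝓤]
        by_cases h𝓥 : cluster ends ω t ∈ 𝓥
        · rw [Set.indicator_of_mem (show ω ∈ clusterInEvent ends s 𝓤 ∩ clusterInEvent ends t 𝓥 ∩
              (connEvent ends s t)ᶜ from ⟨⟨h𝓤, h𝓥⟩, hst⟩), Set.indicator_of_mem (hmem.2 h𝓥)]
          simp
        · rw [Set.indicator_of_notMem (show ω ∉ clusterInEvent ends s 𝓤 ∩ clusterInEvent ends t 𝓥 ∩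
              (connEvent ends s t)ᶜ from fun h => h𝓥 h.1.2),
            Set.indicator_of_notMem (fun h => h𝓥 (hmem.1 h))]
          simp
      · rw [Set.indicator_of_notMem (show ω ∉ clusterInEvent ends s 𝓤 ∩ clusterInEvent ends t 𝓥 ∩
            (connEvent ends s t)ᶜ from fun h => h𝓤 h.1.1), Set.indicator_of_notMem h𝓤]
        simp
  -- `E[Φ W] = c W · g W`
  have hΦexp : ∀ W, expect p (Φ W) = c W * delClusterProb p ends t 𝓥 W := by
    intro W
    simp only [Φ, D]
    rw [expect_const_mul, ← prob_eq_expect_indicator]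
    rfl
  rw [prob_eq_expect_indicator]
  have e1 : (clusterInEvent ends s 𝓤 ∩ clusterInEvent ends t 𝓥 ∩
      (connEvent ends s t)ᶜ).indicator (1 : Config E → R) = fun ω => Φ (cluster ends ω s) ω :=
    funext hpt
  rw [e1, expect_tower p hdisj (S := fun ω => cluster ends ω s) hS hΦ]
  simp only [hΦexp]
  unfold expect
  refine Finset.sum_congr rfl fun ω _ => ?_
  simp only [c]
  by_cases hst : t ∈ cluster ends ω s
  · rw [Set.indicator_of_notMem (show cluster ends ω s ∉ {W' : Set V | t ∉ W'} from fun h => h hst),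
      Set.indicator_of_notMem (show ω ∉ (connEvent ends s t)ᶜ from fun h => h hst)]
    simp
  · rw [Set.indicator_of_mem (show cluster ends ω s ∈ {W' : Set V | t ∉ W'} from hst),
      Set.indicator_of_mem (show ω ∈ (connEvent ends s t)ᶜ from hst)]
    simp

/-- **BHK, different clusters** (BHK06 Thm 1.4 for events, multiplied out): for up-sets `𝓤, 𝓥`
of vertex sets, `P(C_s ∈ 𝓤, C_t ∈ 𝓥, s↮t) · P(s↮t) ≤ P(C_s ∈ 𝓤, s↮t) · P(C_t ∈ 𝓥, s↮t)`. -/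
theorem bhk_cross_cluster (p : E → R) (hp : IsProbVec p) (ends : E → Sym2 V) (s t : V)
    {𝓤 𝓥 : Set (Set V)} (h𝓤 : IsUpperSet 𝓤) (h𝓥 : IsUpperSet 𝓥) :
    prob p (clusterInEvent ends s 𝓤 ∩ clusterInEvent ends t 𝓥 ∩ (connEvent ends s t)ᶜ) *
        prob p (connEvent ends s t)ᶜ ≤
      prob p (clusterInEvent ends s 𝓤 ∩ (connEvent ends s t)ᶜ) *
        prob p (clusterInEvent ends t 𝓥 ∩ (connEvent ends s t)ᶜ) := by
  classical
  set g := delClusterProb p ends t 𝓥 with hg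
  have hg_anti : Antitone g := delClusterProb_anti p hp ends t h𝓥
  have hg1 : ∀ W, g W ≤ 1 := delClusterProb_le_one p hp ends t 𝓥
  -- the two tower identities
  have eUV := prob_clusterIn_inter_eq_expect p ends s t 𝓤 𝓥
  have eV := prob_clusterIn_inter_eq_expect p ends s t Set.univ 𝓥
  simp only [Set.indicator_univ, Pi.one_apply, one_mul] at eV
  have eV' : clusterInEvent ends s Set.univ ∩ clusterInEvent ends t 𝓥 ∩ (connEvent ends s t)ᶜ =
      clusterInEvent ends t 𝓥 ∩ (connEvent ends s t)ᶜ := by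
    ext ω; simp [clusterInEvent]
  rw [eV'] at eV
  -- BHK same cluster with `F₁ = 1_𝓤`, `F₂ = 1 − g`
  have hF₁ : Monotone (𝓤.indicator (1 : Set V → R)) := by
    intro W W' h
    by_cases hW : W ∈ 𝓤
    · simp [Set.indicator_of_mem hW, Set.indicator_of_mem (h𝓤 h hW)]
    · rw [Set.indicator_of_notMem hW]
      exact Set.indicator_apply_nonneg fun _ => zero_le_one
  have hF₂ : Monotone (fun W => 1 - g W) := fun W W' h => by
    simp only
    linarith [hg_anti h]
  have hF₁0 : ∀ W, 0 ≤ 𝓤.indicator (1 : Set V → R) W :=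
    fun W => Set.indicator_apply_nonneg fun _ => zero_le_one
  have hF₂0 : ∀ W, 0 ≤ 1 - g W := fun W => by linarith [hg1 W]
  have key := bhk_same_cluster p hp ends s t hF₁ hF₂ hF₁0 hF₂0
  -- rewrite the four expectations
  have eU : expect p (fun ω => 𝓤.indicator 1 (cluster ends ω s) *
      ((connEvent ends s t)ᶜ).indicator 1 ω) =
      prob p (clusterInEvent ends s 𝓤 ∩ (connEvent ends s t)ᶜ) := by
    rw [prob_eq_expect_indicator]
    unfold expect
    refine Finset.sum_congr rfl fun ω _ => ?_
    congr 1
    rw [indicator_inter_one]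
    rfl
  have eR : prob p (connEvent ends s t)ᶜ =
      expect p fun ω => ((connEvent ends s t)ᶜ).indicator 1 ω :=
    prob_eq_expect_indicator p _
  have e2 : expect p (fun ω => (1 - g (cluster ends ω s)) *
      ((connEvent ends s t)ᶜ).indicator 1 ω) =
      prob p (connEvent ends s t)ᶜ - prob p (clusterInEvent ends t 𝓥 ∩ (connEvent ends s t)ᶜ) := by
    rw [eV, eR, ← expect_sub]
    congr 1
    funext ω
    simp only [Pi.sub_apply]
    ring
  have e3 : expect p (fun ω => 𝓤.indicator 1 (cluster ends ω s) * (1 - g (cluster ends ω s)) *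
      ((connEvent ends s t)ᶜ).indicator 1 ω) =
      prob p (clusterInEvent ends s 𝓤 ∩ (connEvent ends s t)ᶜ) -
        prob p (clusterInEvent ends s 𝓤 ∩ clusterInEvent ends t 𝓥 ∩ (connEvent ends s t)ᶜ) := by
    rw [eUV, ← eU, ← expect_sub]
    congr 1
    funext ω
    simp only [Pi.sub_apply]
    ring
  rw [eU, e2, e3] at key
  nlinarith [key]

end Cross

end Summit.Ventures.PercRepro2
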